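import Literature.MathematicalPhysics.QuantumManyBody.PeriodicBoseGas
import HarnessLib

/-!
# The Bogoliubov excitation spectrum in the Gross–Pitaevskii regime (named fact)

Topic `Literature/MathematicalPhysics/QuantumManyBody`, grouping namespace `BoseGas` (the model of
`BoseEinsteinCondensation.lean` / `PeriodicBoseGas.lean`). Vendors, as a NAMED FACT over the periodic
`C¹` form core `PeriodicTrialState` of `PeriodicBoseGas.lean`, the first-gap consequence of

* C. Boccato, C. Brennecke, S. Cenatiempo, B. Schlein, *Bogoliubov theory in the Gross–Pitaevskii
  limit*, Acta Math. 222 (2019) 219–335, arXiv:1801.01389, **Theorem 1.1** (p. 3 of the arXiv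
  version; proof §6 pp. 31–32). [BoccatoEtAl2019Acta]

**What the source prints (Thm. 1.1).** `N` bosons on the unit torus `Λ = [-1/2,1/2]³`,
`H_N = ∑ⱼ -Δ_{xⱼ} + ∑_{i<j} N² V(N(xᵢ - xⱼ))` on `L²_s(Λ^N)` ((1.1), the Gross–Pitaevskii regime),
`V ∈ L³(ℝ³)` non-negative, spherically symmetric, compactly supported, scattering length `𝔞₀`
(zero-energy equation `(-Δ + ½V)f = 0`, `8π𝔞₀ = ∫ V f`). Then (i)
`E_N = 4π(N-1)𝔞₀ + e_Λ 𝔞₀² - ½ ∑_{p ∈ Λ*₊} [p² + 8π𝔞₀ - √(|p|⁴ + 16π𝔞₀p²) - (8π𝔞₀)²/(2p²)] + O(N^{-1/4})`,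
`Λ*₊ = 2πℤ³ ∖ {0}`; (ii) the spectrum of `H_N - E_N` below a threshold `ζ` consists of eigenvalues
`∑_{p ∈ Λ*₊} n_p √(|p|⁴ + 16π𝔞₀ p²) + O(N^{-1/4}(1 + ζ³))`, `n_p ∈ ℕ`. The proof (§6, (6.2)–(6.6))
establishes `|λ_m - ν_m| ≤ C N^{-1/4}(1 + ζ³)` for the ordered min–max values `λ₁ ≤ λ₂ ≤ …` of
`H_N - E_N` below `ζ` and the ordered eigenvalues `0 = ν₁ ≤ ν₂ ≤ …` of the diagonal quadratic
(Bogoliubov) operator `𝒟 = ∑ √(|p|⁴+16π𝔞₀p²) a_p^* a_p`.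

**What is vendored.** The case `m = 2` of that min–max statement, in Ky-Fan form (the sum of
the two lowest eigenvalues of a self-adjoint operator bounded below with compact resolvent is the
infimum of `⟨Ψ₁,HΨ₁⟩ + ⟨Ψ₂,HΨ₂⟩` over orthonormal pairs in a form core): with `ν₂ = e(2π)`,
`e(p) := √(p⁴ + 16π𝔞₀p²)` (one phonon at the smallest momentum `|p| = 2π`),
`|kyFanTwo - 2E_N - e(2π)| ≤ C N^{-1/4}` for `N ≥ N₀`, written as two `ℝ≥0∞` inequalities. The
tree's units (`ħ = 2m = 1`, scattering length by the Lieb–Yngvason variational principle with the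
factor `½`, `PeriodicBoseGas.lean`) are exactly BBCS's (`-Δ`, `(-Δ + ½V)f = 0`); the torus
interaction `N²V(N·)` is the periodisation `periodizedPotential (gpScaledPotential V N) 1`, whose
Fourier coefficients are BBCS's `N⁻¹ V̂(r/N)` ((2.1) of the source); `[0,1)³` and `[-1/2,1/2]³` are
both fundamental cells. Part (i) (the order-one energy with the constant `e_Λ`) and the higher
min–max values are deliberately NOT vendored here.

**Why it is here.** It is the nearest printed theorem to the thermodynamic-limit spectral-gap
cruxes of the `BoseEinsteinCondensation` routes (e.g. `BECNudgeWalk.NudgeGap`, Ky-Fan form of a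
first gap `≥ c√(ρa s)`); it holds only at Gross–Pitaevskii density (`N` particles in a box of
the size of the healing length), which is exactly the gap between print and those items.
Grounds `Summit.AtomisticToContinuum.BoseEinsteinCondensation.Theses.BECNudgeWalk.NudgeGap` as an
anchor hypothesis only (the item is strictly stronger: thermodynamic box, Dirichlet walls).

Mathlib has no many-body Schrödinger operators / min–max for unbounded operators in this form
(searched `Bogoliubov`, `minmax`, `Rayleigh` — only finite-dimensional `Matrix.IsHermitian`
eigenvalue theory and `Literature.Analysis.InnerProduct.KyFanTwoSmallest` in finite dimension);
hence the variational (form-core) phrasing over the existing `PeriodicTrialState`.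
-/

noncomputable section

open MeasureTheory
open scoped ENNReal NNReal ComplexConjugate

namespace Literature.MathematicalPhysics.QuantumManyBody.BoseGas

/-- The **Gross–Pitaevskii-scaled pair-potential profile** `V_N(r) = N² V(N r)` of a radial
profile `V` (so that `x ↦ V_N(|x|)` has scattering length `𝔞₀(V)/N` and range `R₀/N`).
[cite: BoccatoEtAl2019Acta, Thm 1.1 (1.1)] -/
def gpScaledPotential (V : ℝ → ℝ≥0∞) (N : ℕ) : ℝ → ℝ≥0∞ :=
  fun r => (N : ℝ≥0∞) ^ 2 * V ((N : ℝ) * r)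

/-- The **Bogoliubov dispersion in the Gross–Pitaevskii regime** on the unit torus,
`e_𝔞(p) = √(|p|⁴ + 16π 𝔞 |p|²)` (as a function of the modulus `p = |p|` and the scattering
length `𝔞`). [cite: BoccatoEtAl2019Acta, Thm 1.1] -/
def bogoliubovDispersionGP (a p : ℝ) : ℝ :=
  Real.sqrt (p ^ 4 + 16 * Real.pi * a * p ^ 2)

/-- The **Ky-Fan two-sum** of the periodic `N`-body Hamiltonian with pair-potential profile `v`
on the torus of side `L`: the infimum of `⟨Ψ₁, HΨ₁⟩ + ⟨Ψ₂, HΨ₂⟩` over pairs of periodic `C¹`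
Bose-symmetric normalised trial states that are orthogonal in `L²` of the fundamental cell.
For `H` bounded below with compact resolvent this is `λ₀ + λ₁`, the sum of the two lowest
eigenvalues counted with multiplicity (Ky Fan's variational principle; the `C¹` periodic states
are a form core). `⊤` if `L ≤ 0` (no trial states). [folklore] -/
def kyFanTwo (v : ℝ → ℝ≥0∞) (N : ℕ) (L : ℝ) : ℝ≥0∞ :=
  ⨅ (Ψ₁ : PeriodicTrialState N L) (Ψ₂ : PeriodicTrialState N L)
    (_ : ∫ X in cellN N L, conj (Ψ₁.ψ X) * Ψ₂.ψ X = 0),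
    periodicEnergy v Ψ₁ + periodicEnergy v Ψ₂

/-- **Boccato–Brennecke–Cenatiempo–Schlein 2019, Theorem 1.1 (first excitation energy in the
Gross–Pitaevskii regime), min–max form.** Let `V : ℝ → ℝ≥0∞` be a measurable radial pair-potential
profile with `x ↦ V(|x|)` in `L³(ℝ³)` and compactly supported (non-negative and spherically symmetric by
construction), with scattering length `𝔞₀ = scatteringLength V` (finite). For the `N`-boson
Hamiltonian `H_N = ∑ⱼ -Δⱼ + ∑_{i<j} N²V(N(xᵢ-xⱼ))` on the unit torus (periodised interaction,
`periodicEnergy (gpScaledPotential V N)` at `L = 1`, ground-state energy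
`E_N = periodicGroundStateEnergy (gpScaledPotential V N) N 1`) there are `C` and `N₀` such that
for all `N ≥ N₀` the Ky-Fan two-sum `K_N = inf {⟨Ψ₁,H_NΨ₁⟩ + ⟨Ψ₂,H_NΨ₂⟩ : Ψ₁ ⊥ Ψ₂}` satisfies
`2E_N + e(2π) - C N^{-1/4} ≤ K_N ≤ 2E_N + e(2π) + C N^{-1/4}`, `e(p) = √(p⁴ + 16π𝔞₀p²)`:
the first excited eigenvalue of `H_N` is `E_N + √((2π)⁴ + 16π𝔞₀(2π)²) + O(N^{-1/4})` — the
`m = 2` case of `|λ_m - ν_m| ≤ C N^{-1/4}(1+ζ³)` ((6.2)–(6.6) of the source, proof of Thm. 1.1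
(ii)) at a fixed threshold `ζ > e(2π) + 1`. Printed for `V ∈ L³` (no hard core); constants may
depend on `V`. Grounds `Summit.AtomisticToContinuum.BoseEinsteinCondensation.Theses.BECNudgeWalk.NudgeGap`
(as a Gross–Pitaevskii-scale anchor only). [cite: BoccatoEtAl2019Acta, Thm 1.1] -/
def BoccatoEtAl2019Acta_firstExcitation : Prop :=
  ∀ (V : ℝ → ℝ≥0∞), Measurable V → (∫⁻ x : Space, V ‖x‖ ^ 3) ≠ ⊤ → (∃ R₀ : ℝ, ∀ r, R₀ ≤ r → V r = 0) →
  ∃ (C : ℝ) (N₀ : ℕ), ∀ N : ℕ, N₀ ≤ N →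
    let a : ℝ := (scatteringLength V).toReal
    let e₁ : ℝ := bogoliubovDispersionGP a (2 * Real.pi)
    let E : ℝ≥0∞ := periodicGroundStateEnergy (gpScaledPotential V N) N 1
    let K : ℝ≥0∞ := kyFanTwo (gpScaledPotential V N) N 1
    K ≤ 2 * E + ENNReal.ofReal (e₁ + C * (N : ℝ) ^ (-(1 / 4 : ℝ))) ∧
      2 * E + ENNReal.ofReal (e₁ - C * (N : ℝ) ^ (-(1 / 4 : ℝ))) ≤ K

end Literature.MathematicalPhysics.QuantumManyBody.BoseGas

end
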